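import Summits.ValiantsHypothesis.ValiantsHypothesis.Theorems.KPlusLogSqLawTridiagonalRealStaticFourByFourMultCount

/-!
# Route «KPlusLogSqLaw», crux `WeakLifting` (stmt-ValiantsHypothesis-19561) — REAL side of the tridiagonal sector:
# `B 4 ≤ 3` WITH MULTIPLICITY for ALL static definite tridiagonal `4 × 4` designs (zero links included), in the desk's typed currency

HONEST FRAMING.  Helper (`--supports stmt-ValiantsHypothesis-19561 --as helper`), seat val-sym-lift-p3 (g10), cell `pub-symmetroid`,
2026-08-28.  `…FourByFourMultCount` proved `Σ mult ≤ 3` for designs with NONZERO links; here the zero-link cases are added (the continuant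
splits, `pathDet_split`, and the factors of sizes `1, 2, 3` carry `0, ≤ 1, ≤ 2` positive zeros with multiplicity by Descartes), and the
statement is rephrased in the typed currency of the α target of record `staticTridiagonal_definite_posRoots_le` (R2102/R2114: `c`, `e`
symmetric, `c = 0` off the band, `0 < c i i`): **`countP_roots_pos_four_le_three_all`** — every real symmetric tridiagonal `4 × 4` matrix of
monomials with positive diagonal coefficients has at most THREE positive determinant zeros COUNTED WITH MULTIPLICITY (the cell's row `B 4 ≤ 3`,
lift-p2 g9 `card_posRoots_four_le_three_all`, counted distinct zeros).  Calibration row at one size; α does not move.  Nothing here bears on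
`WeakLifting` / `TropicalB` (stmt-19771) in their windows, on Conjecture B, on the Door-A registers, on `MatrixDescartes` (stmt-18050) or on VP ≠ VNP.
[folklore; this seat's files p584534/p585185/p585873]
-/

-- `Summit.ValiantsHypothesis.ValiantsHypothesis.…` repeats a component by the D-0017 layout (single-conjunct summit); the name is mandated.
set_option linter.dupNamespace false
set_option autoImplicit false

namespace Summit.ValiantsHypothesis.ValiantsHypothesis.Theorems.KPlusLogSqLaw

namespace StaticTridiagonalRealPotential

open Polynomial

variable (a : ℕ → ℝ) (d : ℕ → ℕ) (b : ℕ → ℝ) (f : ℕ → ℕ)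

/-- Positive zeros with multiplicity of a product are those of the factors (or none if the product vanishes). [folklore] -/
theorem countP_roots_pos_mul_le (P Q : ℝ[X]) (p q : ℕ) (hP : P.roots.countP (fun x => 0 < x) ≤ p) (hQ : Q.roots.countP (fun x => 0 < x) ≤ q) :
    (P * Q).roots.countP (fun x => 0 < x) ≤ p + q := by
  by_cases h : P * Q = 0
  · rw [h, roots_zero]; simp
  · rw [roots_mul h, Multiset.countP_add]; exact Nat.add_le_add hP hQ

/-- **`B 4 ≤ 3` WITH MULTIPLICITY in the continuant currency, ALL designs** (zero links allowed; diagonal coefficients positive). [this file] -/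
theorem countP_roots_pos_pathDet_four_le_three_all (ha : ∀ t, 0 < a t) :
    (pathDet a d b f 4).roots.countP (fun x => 0 < x) ≤ 3 := by
  classical
  by_cases hz : ∃ t, t < 3 ∧ b t = 0
  · obtain ⟨t, ht, hbt⟩ := hz
    -- the continuant splits at the zero link `t ∈ {0, 1, 2}`
    have h3 : t = 0 ∨ t = 1 ∨ t = 2 := by omega
    rcases h3 with rfl | rfl | rfl
    · rw [show (4 : ℕ) = 0 + 1 + 3 from rfl, pathDet_split a d b f hbt 3]
      refine (countP_roots_pos_mul_le _ _ 0 3 (le_of_eq (countP_roots_pos_pathDet_one a d b f)) ?_).trans (by norm_num)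
      exact (countP_roots_pos_pathDet_three _ _ _ _).trans (by norm_num)
    · rw [show (4 : ℕ) = 1 + 1 + 2 from rfl, pathDet_split a d b f hbt 2]
      exact (countP_roots_pos_mul_le _ _ 1 1 (countP_roots_pos_pathDet_two a d b f) (countP_roots_pos_pathDet_two _ _ _ _)).trans (by norm_num)
    · rw [show (4 : ℕ) = 2 + 1 + 1 from rfl, pathDet_split a d b f hbt 1]
      refine (countP_roots_pos_mul_le _ _ 2 0 (countP_roots_pos_pathDet_three a d b f) (le_of_eq (countP_roots_pos_pathDet_one _ _ _ _))).trans
        (by norm_num)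
  · -- all links of the `4 × 4` design are nonzero: replace the irrelevant links beyond the size by `1`
    push Not at hz
    have hb' : ∀ t, (if t < 3 then b t else (1 : ℝ)) ≠ 0 := by
      intro t; split_ifs with h
      · exact hz t h
      · exact one_ne_zero
    rw [pathDet_congr (a := a) (a' := a) (d := d) (d' := d) (b := b) (b' := fun t => if t < 3 then b t else 1) (f := f) (f' := f) (n := 4)
      (fun _ _ => rfl) (fun _ _ => rfl) (fun t ht => by rw [if_pos (by omega)]) (fun _ _ => rfl)]
    exact countP_roots_pos_pathDet_four_le_three a d _ f ha hb'

/-- **`B 4 ≤ 3` WITH MULTIPLICITY (all designs, the desk's typed currency)**: every real symmetric tridiagonal `4 × 4` matrix of monomials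
`c i j · X ^ (e i j)` (`c`, `e` symmetric, `c = 0` off the band, `0 < c i i`) has at most three positive determinant zeros COUNTED WITH
MULTIPLICITY — sharpening the cell's row `B 4 ≤ 3` (lift-p2 g9, distinct zeros). [this file] -/
theorem countP_roots_pos_four_le_three_all (c : Fin 4 → Fin 4 → ℝ) (e : Fin 4 → Fin 4 → ℕ) (hc : ∀ i j, c i j = c j i)
    (he : ∀ i j, e i j = e j i) (hband : ∀ i j : Fin 4, (i : ℕ) + 1 < j ∨ (j : ℕ) + 1 < i → c i j = 0) (hpos : ∀ i, 0 < c i i) :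
    (Matrix.det (Matrix.of fun i j => C (c i j) * (X : ℝ[X]) ^ e i j)).roots.countP (fun x => 0 < x) ≤ 3 := by
  rw [det_of_eq_pathDet c e hc he hband]
  refine countP_roots_pos_pathDet_four_le_three_all _ _ _ _ fun t => ?_
  by_cases h : t < 4
  · rw [dif_pos h]; exact hpos _
  · rw [dif_neg h]; exact one_pos

end StaticTridiagonalRealPotential

end Summit.ValiantsHypothesis.ValiantsHypothesis.Theorems.KPlusLogSqLaw
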